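import Summits.ResolutionOfSingularities.ResolutionOfSingularities.Theorems.WildPurityWildSymbolPeriodicTransport
import HarnessLib

/-!
# `WildSymbol` (stmt-ResolutionOfSingularities-17133), line `birth` — transport under invariance
# MODULO integral classes (a weakening of hypothesis (iii) of the periodic tower)

Support file for crux #2 of route `ResolutionOfSingularities/WildPurity`
(`Summit.ResolutionOfSingularities.ResolutionOfSingularities.Theses.WildPurity.WildSymbol`), line `birth`.
The landed transport `stub_periodicTransport` (`Theorems/WildPurityWildSymbolPeriodicTransport.lean`) asks
that the class `α` be FIXED by the automorphism `Φ_{σ⁻¹}` of `G ⧸ N` (hypothesis (iii) of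
`PeriodicTower`). The same conclusion holds under the weaker, more natural hypothesis that `α` is fixed
only MODULO `S`-integral classes: `Φ_{σ⁻¹} α − α ∈ Unr S` (registered sub-goal
`transport_of_invariant_mod_Unr`; lift form `transport_of_invariant_mod_Unr'`). Reason: `Φ_{σ⁻¹}` maps
`Unr S` into itself (chart step `σ⁻¹ S ⊆ S`), so `Φ_{σ⁻¹}ⁿ α ≡ α (mod Unr S)` for every `n`, and the finite
bookkeeping `exists_iterate_quotMap_mem_Unr` puts `Φ_{σ⁻¹}ⁿ α` in `Unr S` for `n` large when `α ∈ Unr O`.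

Why it matters for the line (lead's note): with `D(S) := {divisorially integral classes} / Unr S` (an
`𝔽_p`-vector space; "LocalCandidate at `S`" says `D(S) ≠ 0`) and the KANGAROO MONODROMY
`ψ = Φ_{σ⁻¹} ∘ ι : D(S) → D(S)` (`ι : D(S) → D(σS)` the inclusion, `Φ_{σ⁻¹} : D(σS) ≅ D(S)`), a class usable
by THIS transport is exactly a non-zero FIXED VECTOR of `ψ`; replacing `σ` by `σʳ` (same basin) a non-zero
`ψ`-recurrent vector suffices, which exists iff `ψ` is not nilpotent when `D(S)` is finite-dimensional. So
the self-similar germ becomes a finite linear-algebra certificate: (S, σ) with `D(S) ≠ 0` and `ψ` not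
nilpotent — the computable form of the route's "LocalCandidateAt(germ) → DefectSurvival".

No definition is declared; nothing concludes the crux positively.
-/

noncomputable section

-- single-problem summit: the doubled namespace component `ResolutionOfSingularities` is forced
set_option linter.dupNamespace false

namespace Summit.ResolutionOfSingularities.ResolutionOfSingularities.Theorems.WildSymbol.Birth

/-- **Transport under invariance modulo `Unr S`.** Let `σ⁻¹ S ⊆ S` (chart step) and let `O` be
exhausted by the tower `⋃ₙ σⁿ S`. If `Φ_{σ⁻¹} α − α ∈ Unr S` and `α ∉ Unr S`, then `α ∉ Unr O`.
[folklore] -/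
theorem transport_of_invariant_mod_Unr (p : ℕ) (K : Type) [Field K] (σ : K ≃+* K) (O : ValuationSubring K) (S : Subring K) (α : G K ⧸ N p K) (h1 : ∀ x : K, x ∈ S → σ.symm x ∈ S) (h2 : ∀ x : K, x ∈ O → ∃ (n : ℕ) (y : K), y ∈ S ∧ x = σ^[n] y) (h3 : QuotientAddGroup.map (N p K) (N p K) (FreeAbelianGroup.map (tripleMap σ.symm)) (N_le_comap p σ.symm) α - α ∈ Unr p K S) (hS : α ∉ Unr p K S) : α ∉ Unr p K O.toSubring := by
  intro hα
  apply hS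
  -- every power of `Φ_{σ⁻¹}` fixes `α` modulo `Unr S`
  have key : ∀ n : ℕ,
      (QuotientAddGroup.map (N p K) (N p K) (FreeAbelianGroup.map (tripleMap σ.symm))
        (N_le_comap p σ.symm))^[n] α - α ∈ Unr p K S := by
    intro n
    induction n with
    | zero => rw [Function.iterate_zero_apply, sub_self]; exact (Unr p K S).zero_mem
    | succ n ih =>
      rw [Function.iterate_succ_apply']
      have e : QuotientAddGroup.map (N p K) (N p K) (FreeAbelianGroup.map (tripleMap σ.symm))
            (N_le_comap p σ.symm)
            ((QuotientAddGroup.map (N p K) (N p K) (FreeAbelianGroup.map (tripleMap σ.symm))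
              (N_le_comap p σ.symm))^[n] α) - α
          = QuotientAddGroup.map (N p K) (N p K) (FreeAbelianGroup.map (tripleMap σ.symm))
              (N_le_comap p σ.symm)
              ((QuotientAddGroup.map (N p K) (N p K) (FreeAbelianGroup.map (tripleMap σ.symm))
                (N_le_comap p σ.symm))^[n] α - α)
            + (QuotientAddGroup.map (N p K) (N p K) (FreeAbelianGroup.map (tripleMap σ.symm))
                (N_le_comap p σ.symm) α - α) := by
        rw [map_sub]; abel
      rw [e]
      exact (Unr p K S).add_mem (quotMap_mem_Unr p σ.symm h1 ih) h3
  -- and some power sends `α ∈ Unr O` into `Unr S`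
  obtain ⟨n, hn⟩ := exists_iterate_quotMap_mem_Unr p σ O S h1 h2 hα
  have e : α = (QuotientAddGroup.map (N p K) (N p K) (FreeAbelianGroup.map (tripleMap σ.symm))
        (N_le_comap p σ.symm))^[n] α
      - ((QuotientAddGroup.map (N p K) (N p K) (FreeAbelianGroup.map (tripleMap σ.symm))
          (N_le_comap p σ.symm))^[n] α - α) := by abel
  rw [e]
  exact (Unr p K S).sub_mem hn (key n)

/-- **Lift form** (no quotient map in the statement, matching the shape of `PeriodicTower` (iii)): if
`α` has a lift `g ∈ G` such that the class of `tripleMap σ⁻¹ · g` differs from `α` by an `S`-integral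
class, and `α ∉ Unr S`, then `α ∉ Unr O`. [folklore] -/
theorem transport_of_invariant_mod_Unr' (p : ℕ) (K : Type) [Field K] (σ : K ≃+* K)
    (O : ValuationSubring K) (S : Subring K) (α : G K ⧸ N p K)
    (h1 : ∀ x : K, x ∈ S → σ.symm x ∈ S)
    (h2 : ∀ x : K, x ∈ O → ∃ (n : ℕ) (y : K), y ∈ S ∧ x = σ^[n] y)
    (h3 : ∃ g : G K, (g : G K ⧸ N p K) = α ∧
      ((FreeAbelianGroup.map (tripleMap σ.symm) g : G K) : G K ⧸ N p K) - α ∈ Unr p K S)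
    (hS : α ∉ Unr p K S) : α ∉ Unr p K O.toSubring := by
  obtain ⟨g, hg, hmod⟩ := h3
  refine transport_of_invariant_mod_Unr p K σ O S α h1 h2 ?_ hS
  rw [← hg, QuotientAddGroup.map_mk, hg]
  exact hmod

end Summit.ResolutionOfSingularities.ResolutionOfSingularities.Theorems.WildSymbol.Birth

end
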